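import Summits.CriticalPhenomena.PercolationContinuityZ3.Theorems.PercNonProliferationSubpolynomialBlockingStubSixSlab
import Literature.Probability.Percolation.FiniteClusterTailZ2
import HarnessLib

/-!
# Crux `PercNonProliferation.SubpolynomialBlocking` (stmt-CriticalPhenomena-4446), line `root-trick-wall-patch` — stub `stub_enclosureOfBlocking`

Helper file for the crux skeleton `Cruxes/SubpolynomialBlocking/Lines/root_trick_wall_patch.lean`
(lead prover-line-stmt-CriticalPhenomena-4446-1). Proves exactly the registered stub signature
`stub_enclosureOfBlocking`; lands with `--supports stmt-CriticalPhenomena-4446`.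

## The statement (necessity `u_{⌈r/2⌉} ≤ h r`)

At `p = p_c(ℤ³)` let `u_m = Negative.blockProb 3 p_c m = P((annulusCrossing 3 m)ᶜ)` be the
probability that no open path inside `Λ_{2m} = [-2m, 2m]³` joins `Λ_m` to `∂ⁱⁿΛ_{2m}`, and let
`h r = P((openCrossing (hsBall r) (patch r) (farFace r))ᶜ)` be the wall-patch enclosure probability,
where `patch r = {0} × [0, r)²`, `hsBall r = [0, 4r] × [-4r, 5r-1]²` (the order interval
`Set.Icc ![0, -4r, -4r] ![4r, 5r-1, 5r-1]` of `Site 3 = Fin 3 → ℤ`) and `farFace r` is the set of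
points of `hsBall r` with `x₀ = 4r` or a lateral coordinate at an extreme value `-4r`, `5r-1`.
Then `u_{⌈r/2⌉} ≤ h r` for every `r ≥ 1` (`⌈r/2⌉ = (r+1)/2`).

## The argument

Put `m = (r+1)/2`, `v = (0, ⌊r/2⌋, ⌊r/2⌋)` and `τ = zdShiftIso v` (`τ z = z + v`).
* GEOMETRY (`omega`): `patch r ⊆ τ '' Λ_m` and `farFace r ∩ τ '' Λ_{2m} = ∅`
  (`2m ≤ r + 1 < 4r`, `⌊r/2⌋ - 2m > -4r`, `⌊r/2⌋ + 2m < 5r - 1`).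
* DETERMINISTIC (`StubEnclosureOfBlocking.not_mem_openCrossing`): if `ω ⊆ E(ℤ³)` has no open path
  inside `τ '' Λ_{2m}` from `τ '' Λ_m` to `τ '' ∂ⁱⁿΛ_{2m}`, then it has no open path inside
  `hsBall r` from `patch r` to `farFace r`: such a path is a lattice walk
  (`exists_walk_of_mem_openConnIn`) starting in `τ '' Λ_m ⊆ τ '' Λ_{2m}` and ending outside
  `τ '' Λ_{2m}`; its maximal initial segment inside `τ '' Λ_{2m}` (`exists_prefix_exit_edge`) ends
  at a vertex `f` with a lattice neighbour `g ∉ τ '' Λ_{2m}`, so `f - v ∈ ∂ⁱⁿΛ_{2m}`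
  (`mem_innerBoundary_iff`, translation invariance of adjacency `zdGraph_adj_shift_iff`), and is an
  open walk inside `τ '' Λ_{2m}` (`mem_openConnIn_of_walk`) — a shifted annulus crossing.
* MEASURE: `real_mono_of_forall_subset_edgeSet` turns the inclusion into an inequality of
  probabilities, and the shifted blocking event has probability `u_m` by invariance of `P_p` under
  the lattice translation `τ` (`StubSixSlab.real_compl_openCrossing_image`; Grimmett 1999 §1.6),
  since `annulusCrossing 3 m = openCrossing ↑Λ_{2m} ↑Λ_m ↑(∂ⁱⁿΛ_{2m})` definitionally.

No new definitions; all sets are written exactly as in the registered signature.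
-/

noncomputable section

namespace Summit.CriticalPhenomena.PercolationContinuityZ3.Theorems.SubpolynomialBlocking

open MeasureTheory Filter Topology
open Literature.Probability.Percolation Literature.Probability.LatticeModels

namespace StubEnclosureOfBlocking

/-- Membership in the translate of a finite set of sites: `z ∈ τ_v '' Λ ↔ z - v ∈ Λ`
(`τ_v z = z + v`). -/
theorem mem_image_coe_iff {d : ℕ} (v z : Site d) (Λ : Finset (Site d)) :
    z ∈ (zdShiftIso v) '' (↑Λ : Set (Site d)) ↔ z - v ∈ Λ := by
  constructor
  · rintro ⟨w, hw, rfl⟩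
    simpa only [Finset.mem_coe, zdShiftIso_apply, add_sub_cancel_right] using hw
  · intro h
    exact ⟨z - v, Finset.mem_coe.2 h, by simp only [zdShiftIso_apply, sub_add_cancel]⟩

/-- Membership in a translated centred cube `τ_{(0,a,b)} '' Λ_L`, coordinatewise. -/
theorem mem_image_box_iff {L : ℕ} (a b : ℤ) {z : Site 3} :
    z ∈ (zdShiftIso (![0, a, b] : Site 3)) '' (↑(box 3 L) : Set (Site 3)) ↔
      (-(L : ℤ) ≤ z 0 ∧ z 0 ≤ (L : ℤ)) ∧ (-(L : ℤ) ≤ z 1 - a ∧ z 1 - a ≤ (L : ℤ)) ∧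
        (-(L : ℤ) ≤ z 2 - b ∧ z 2 - b ≤ (L : ℤ)) := by
  have h0 : (z - ![0, a, b]) 0 = z 0 := by simp
  have h1 : (z - ![0, a, b]) 1 = z 1 - a := by simp
  have h2 : (z - ![0, a, b]) 2 = z 2 - b := by simp
  rw [mem_image_coe_iff, mem_box, Fin.forall_fin_succ, Fin.forall_fin_succ, Fin.forall_fin_succ]
  simp only [IsEmpty.forall_iff, and_true, Fin.succ_zero_eq_one, Fin.succ_one_eq_two, h0, h1, h2]

/-- Translation invariance of adjacency, in subtraction form: `f ∼ g ↔ (f - v) ∼ (g - v)`. -/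
theorem adj_sub_iff (v f g : Site 3) :
    (zdGraph 3).Adj (f - v) (g - v) ↔ (zdGraph 3).Adj f g := by
  have h := zdGraph_adj_shift_iff v (f - v) (g - v)
  simp only [Site.shift_apply, sub_add_cancel] at h
  exact h.symm

/-- **The shifted annulus separates the patch from the far face** (deterministic, lattice
configurations). With `m = (r+1)/2`, `v = (0, ⌊r/2⌋, ⌊r/2⌋)`, `τ = zdShiftIso v`: if `ω ⊆ E(ℤ³)`
has no open path inside `τ '' Λ_{2m}` from `τ '' Λ_m` to `τ '' ∂ⁱⁿΛ_{2m}`, then `ω` has no open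
path inside `hsBall r` from `patch r` to `farFace r` (first exit of the open lattice walk from
`τ '' Λ_{2m}`; the exit vertex is a translate of an inner-boundary vertex). No hypothesis `r ≥ 1`
is needed: for `r = 0` the patch is empty. -/
theorem not_mem_openCrossing {r : ℕ} {ω : BondConfig (Site 3)}
    (hω : ω ⊆ (zdGraph 3).edgeSet)
    (h : ω ∉ openCrossing
        ((zdShiftIso (![0, ((r / 2 : ℕ) : ℤ), ((r / 2 : ℕ) : ℤ)] : Site 3)) ''
          (↑(box 3 (2 * ((r + 1) / 2))) : Set (Site 3)))
        ((zdShiftIso (![0, ((r / 2 : ℕ) : ℤ), ((r / 2 : ℕ) : ℤ)] : Site 3)) ''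
          (↑(box 3 ((r + 1) / 2)) : Set (Site 3)))
        ((zdShiftIso (![0, ((r / 2 : ℕ) : ℤ), ((r / 2 : ℕ) : ℤ)] : Site 3)) ''
          (↑(innerBoundary (zdGraph 3) (box 3 (2 * ((r + 1) / 2)))) : Set (Site 3)))) :
    ω ∉ openCrossing
        (Set.Icc (![0, -(4 * (r : ℤ)), -(4 * (r : ℤ))] : Site 3)
          ![4 * (r : ℤ), 5 * (r : ℤ) - 1, 5 * (r : ℤ) - 1])
        {x : Site 3 | x 0 = 0 ∧ 0 ≤ x 1 ∧ x 1 < (r : ℤ) ∧ 0 ≤ x 2 ∧ x 2 < (r : ℤ)}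
        {y : Site 3 | y ∈ Set.Icc (![0, -(4 * (r : ℤ)), -(4 * (r : ℤ))] : Site 3)
            ![4 * (r : ℤ), 5 * (r : ℤ) - 1, 5 * (r : ℤ) - 1] ∧
          (y 0 = 4 * (r : ℤ) ∨ y 1 = -(4 * (r : ℤ)) ∨ y 1 = 5 * (r : ℤ) - 1 ∨
            y 2 = -(4 * (r : ℤ)) ∨ y 2 = 5 * (r : ℤ) - 1)} := by
  rw [mem_openCrossing_iff]
  rintro ⟨x, ⟨hx0, hx1, hx1', hx2, hx2'⟩, y, ⟨-, hy⟩, hxy⟩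
  obtain ⟨P, -, hPω⟩ := exists_walk_of_mem_openConnIn hω hxy
  set a : ℤ := ((r / 2 : ℕ) : ℤ) with ha
  set m : ℕ := (r + 1) / 2 with hm
  have har : 2 * (r / 2) ≤ r ∧ r < 2 * (r / 2) + 2 := by omega
  have hmr : 2 * m ≤ r + 1 ∧ r < 2 * m + 1 := by omega
  -- `x ∈ τ '' Λ_{2m}` and `y ∉ τ '' Λ_{2m}`.
  have hxS : x ∈ (zdShiftIso (![0, a, a] : Site 3)) '' (↑(box 3 (2 * m)) : Set (Site 3)) := by
    rw [mem_image_box_iff]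
    push_cast
    omega
  have hyS : y ∉ (zdShiftIso (![0, a, a] : Site 3)) '' (↑(box 3 (2 * m)) : Set (Site 3)) := by
    rw [mem_image_box_iff]
    push_cast
    omega
  -- FIRST EXIT from `τ '' Λ_{2m}`.
  obtain ⟨f, g, hfS, hgS, hadj, -, -, P', -, hP'e, hP'S⟩ := exists_prefix_exit_edge _ P hxS hyS
  refine h ⟨x, ?_, f, ?_, mem_openConnIn_of_walk P' hP'S fun e he => hPω e (hP'e e he)⟩
  · -- `x ∈ τ '' Λ_m`
    rw [mem_image_box_iff]
    omega
  · -- `f ∈ τ '' ∂ⁱⁿΛ_{2m}`: `f - v ∈ Λ_{2m}` has the lattice neighbour `g - v ∉ Λ_{2m}`.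
    rw [mem_image_coe_iff, mem_innerBoundary_iff]
    exact ⟨(mem_image_coe_iff _ f _).1 hfS, g - ![0, a, a],
      fun hg => hgS ((mem_image_coe_iff _ g _).2 hg), (adj_sub_iff _ f g).2 hadj⟩

/-- The annulus-crossing event is the open crossing of `Λ_{2m}` from `Λ_m` to `∂ⁱⁿΛ_{2m}`
(definitional). -/
theorem openCrossing_box_eq_annulusCrossing (d m : ℕ) :
    openCrossing (↑(box d (2 * m)) : Set (Site d)) (↑(box d m) : Set (Site d))
        (↑(innerBoundary (zdGraph d) (box d (2 * m))) : Set (Site d)) =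
      Literature.Barriers.CriticalPhenomena.annulusCrossing d m :=
  rfl

/-- **The shifted blocking event has probability `u_m`**: invariance of `P_p` under the lattice
translation `τ = zdShiftIso v` (`StubSixSlab.real_compl_openCrossing_image`, Grimmett 1999 §1.6). -/
theorem real_compl_openCrossing_shift_eq_blockProb (p : unitInterval) (v : Site 3) (m : ℕ) :
    (bondPercolation (zdGraph 3) p).real
        (openCrossing ((zdShiftIso v) '' (↑(box 3 (2 * m)) : Set (Site 3)))
          ((zdShiftIso v) '' (↑(box 3 m) : Set (Site 3)))
          ((zdShiftIso v) '' (↑(innerBoundary (zdGraph 3) (box 3 (2 * m))) : Set (Site 3))))ᶜ =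
      Negative.blockProb 3 p m := by
  rw [StubSixSlab.real_compl_openCrossing_image, openCrossing_box_eq_annulusCrossing]
  rfl

end StubEnclosureOfBlocking

/-- **Registered stub `stub_enclosureOfBlocking`** (line `root-trick-wall-patch`, crux
`SubpolynomialBlocking`): NECESSITY `u_{⌈r/2⌉} ≤ h r` for `r ≥ 1`, where
`u_m = Negative.blockProb 3 p_c m = P_{p_c}((annulusCrossing 3 m)ᶜ)` and
`h r = P_{p_c}((openCrossing (hsBall r) (patch r) (farFace r))ᶜ)` is the critical wall-patch
enclosure probability (`patch r = {0} × [0,r)²`, `hsBall r = [0,4r] × [-4r,5r-1]²`, `farFace r` the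
points of `hsBall r` at depth `4r` or extreme lateral coordinate). Proof: the translate by
`v = (0, ⌊r/2⌋, ⌊r/2⌋)` of the annulus `Λ_{2m} ∖ Λ_m`, `m = ⌈r/2⌉`, contains the patch in its hole
and misses the far face, so blocking of the translated annulus (probability `u_m` by translation
invariance) forces the enclosure event on lattice configurations (first-exit argument,
`StubEnclosureOfBlocking.not_mem_openCrossing`); `real_mono_of_forall_subset_edgeSet`. -/
theorem stub_enclosureOfBlocking :
    ∀ r : ℕ, 1 ≤ r → Negative.blockProb 3 (criticalProbI 3) ((r + 1) / 2) ≤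
      (bondPercolation (zdGraph 3) (criticalProbI 3)).real
          (openCrossing
            (Set.Icc (![0, -(4 * (r : ℤ)), -(4 * (r : ℤ))] : Site 3) ![4 * (r : ℤ), 5 * (r : ℤ) - 1, 5 * (r : ℤ) - 1])
            {x : Site 3 | x 0 = 0 ∧ 0 ≤ x 1 ∧ x 1 < (r : ℤ) ∧ 0 ≤ x 2 ∧ x 2 < (r : ℤ)}
            {y : Site 3 | y ∈ Set.Icc (![0, -(4 * (r : ℤ)), -(4 * (r : ℤ))] : Site 3)
                ![4 * (r : ℤ), 5 * (r : ℤ) - 1, 5 * (r : ℤ) - 1] ∧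
              (y 0 = 4 * (r : ℤ) ∨ y 1 = -(4 * (r : ℤ)) ∨ y 1 = 5 * (r : ℤ) - 1 ∨
                y 2 = -(4 * (r : ℤ)) ∨ y 2 = 5 * (r : ℤ) - 1)})ᶜ := by
  intro r _
  rw [← StubEnclosureOfBlocking.real_compl_openCrossing_shift_eq_blockProb (criticalProbI 3)
    (![0, ((r / 2 : ℕ) : ℤ), ((r / 2 : ℕ) : ℤ)] : Site 3) ((r + 1) / 2)]
  exact DCT16.real_mono_of_forall_subset_edgeSet (zdGraph 3) (criticalProbI 3) fun ω hω hA =>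
    StubEnclosureOfBlocking.not_mem_openCrossing hω hA

end Summit.CriticalPhenomena.PercolationContinuityZ3.Theorems.SubpolynomialBlocking

end
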